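import Summits.BirchSwinnertonDyer.BirchSwinnertonDyer.Theorems.PrintCf2SplitBadTwoKummerBranchFrame
import Summits.BirchSwinnertonDyer.BirchSwinnertonDyer.Theorems.PrintCf2SplitBadTwoRestrictedSelmerBottomKummerEigen
import Summits.BirchSwinnertonDyer.BirchSwinnertonDyer.Theorems.PrintCf2SplitBadTwoCMShaEigenImageSurj
import Summits.BirchSwinnertonDyer.BirchSwinnertonDyer.Theorems.PrintCf2SplitBadTwoRestrictedSelmerBottomLocalKummerRankOne
import Summits.BirchSwinnertonDyer.BirchSwinnertonDyer.Theorems.PrintCf2SplitBadTwoLocalPointsTrichotomy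
import HarnessLib

/-!
# Crux `PrintCf2.SplitBadTwoRankOneOfFacts` (stmt-BirchSwinnertonDyer-20368), road α v10.3, S3c residual (R-BV): `hH2` ((H2), Agboola's
# BOTTOM EXHAUSTION at `v̄`) of cut 14 `restrictedControl_two_of_ptFacts_F1_F3_H2`, VERBATIM, is a theorem

Cell `bsd-print-cf2`, width seat `bsd-line-cf2-p1-w2` g11 (prover-bsd-line-cf2-p1-w2-g11-0), executing -w7 g3's published recipe (STATUS
22:10:17Z / 22:59:59Z; their producer was blocked by a farm olean); `--supports stmt-BirchSwinnertonDyer-20368` (helper, Theses-free).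
HONEST FRAMING: nothing here closes the crux or a registered stub; BSD is not proved by any of this; no summit statement is proved by this seat.
No definition, no named fact, no `sorry`, no kit. beyond-print theorem: no.

WHAT. The hypothesis `hH2` of LEAD cut 14 (p677854 `RestrictedSelmerPair.restrictedControl_two_of_ptFacts_F1_F3_H2`) reads, per frame:
`loc_v̄(𝔖_v(K, W*) ⊓ ι_*⁻¹(classical at v̄)) ≤ loc_v̄(Q_M)`, `Q_M = ι_*⁻¹(res_⊤ range κ)` — every class of the Greenberg-shaped restricted group
that is locally Kummer at `v̄` has, ON `D_v̄`, the restriction of a class on the global Kummer line (Agboola Prop. 6.11, "since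
`E(K_{𝔭*}) ⊗ D` is cocyclic the bottom map is onto"). PROOF (-w7 g3's recipe, all inputs in the tree):
* `rankOne_rel_localPoints_of_frame` — the RANK-ONE RELATION for `Γ_{K_w}`-fixed points of `E(K̄_w)` at a dyadic place `w` of the frame
  (`K_w ≅ ℚ₂`): -w7 g3 `LocalPointsScalar.exists_rankOne_rel_adicCompletion_two` (Silverman VII.6.3) transported along Galois descent
  (`exists_map_eq_of_forall_smul_localPoints_eq`, -w3 g9 `LocalTrichotomy.smul_map_baseChange_eq`), with base point the descent of
  `pointsMap (toGeomPoints P_K)` (non-torsion: `pointsMapOfEmb_injective`, `toGeomPoints_injective`);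
* -w7 g3 `exists_resOfLe_eq_zsmul_resOfLe_kummer` (p672775): `res_{D_v̄}(ι_* x) = M • res_{D_v̄}(res_⊤ κ_n(P_K))`;
* the equivariant eigen-projector `e` (`endEigenPrimaryTorsion_compl_of_frame`, `exists_eigenProjector`), `e_* ∘ ι_* = id`
  (`resH1Hom_proj_comp_subtype`), `res ∘ ψ_* = ψ_* ∘ res` (`CMPrimes.resOfLe_resH1Hom_id_comm`), and `M • e_* res_⊤ κ(t) ∈ Q_M`
  (-w7 g3 `zsmul_proj_resSubgroup_kummer_mem_comap_kummer`, p672215; `kummerMapPInfty_tmul_prufGen`).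
**`hH2_holds`** is `hH2` VERBATIM (the binders `C`, analytic rank, pinning, `c₀`, `ℓ`, `hfin`, and the `𝔖_v` conjunct are not used).

References: [Agboola2007] §6 Prop. 6.11 (arXiv math/0602192 p0014); [GreenbergLNM1716] §2 Prop. 2.1 and p. 62; [SilvermanAEC2009] Prop. VII.6.3,
VIII §1; [Rubin1999] §2, Prop. 5.4.
-/

noncomputable section

open scoped Classical TensorProduct

set_option linter.dupNamespace false
set_option autoImplicit false

open NumberField IsDedekindDomain Field WeierstrassCurve
open Literature.NumberTheory.EllipticCurves Literature.NumberTheory.EllipticCurves.GreenbergSelmer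
open Literature.NumberTheory.EllipticCurves.Castella2018.AcSelmer
open Literature.NumberTheory.EllipticCurves.Agboola2007
open Literature.NumberTheory.EllipticCurves.ResKernel
open Literature.NumberTheory.GaloisRepresentations

namespace Summit.BirchSwinnertonDyer.BirchSwinnertonDyer.Theorems.PrintCf2.CMPrimes

open Summit.BirchSwinnertonDyer.BirchSwinnertonDyer.Theorems.PrintCf2.RestrictedSelmerPair
open Summit.BirchSwinnertonDyer.BirchSwinnertonDyer.Theorems.PrintCf2.AdditiveAtSeven
open Summit.BirchSwinnertonDyer.BirchSwinnertonDyer.Theorems.PrintCf2.LocalTrichotomy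
open Summit.BirchSwinnertonDyer.BirchSwinnertonDyer.Theorems.PrintCf2.LocalPointsScalar

variable {K : Type} [Field K] [NumberField K]

/-- **The rank-one relation for the `Γ_{K_w}`-fixed points of `E(K̄_w)` at a dyadic place of the frame.** `W/ℚ` elliptic, `K` imaginary
quadratic, `w ≠ w′` the two places above `2` (`K_w ≅ ℚ₂`), `P ∈ W(ℚ)` of infinite order, `P_K` its image in `W(K)`: for every `Γ_{K_w}`-fixed
`y ∈ E(K̄_w)` there is `a` such that for every `K′`, `2^a y ≡ M·P_K (mod 2^{K′} E(K̄_w)^{Γ} + torsion)` — the hypothesis `hrel` of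
`exists_resOfLe_eq_zsmul_resOfLe_kummer`. [cite: SilvermanAEC2009, Prop. VII.6.3 and VIII §1] [cite: Agboola2007, Prop. 6.11 (arXiv p0014)] -/
theorem rankOne_rel_localPoints_of_frame (hK : IsImaginaryQuadratic K) {w w' : HeightOneSpectrum (𝓞 K)}
    (hw : ((2 : ℕ) : 𝓞 K) ∈ w.asIdeal) (hw' : ((2 : ℕ) : 𝓞 K) ∈ w'.asIdeal) (hne : w' ≠ w)
    (W : WeierstrassCurve ℚ) [W.IsElliptic] {P : W.toAffine.Point} (hP : ¬ IsOfFinAddOrder P) :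
    ∀ y : localPoints (W.baseChange K) (w.adicCompletion K), (∀ σ : absoluteGaloisGroup (w.adicCompletion K), σ • y = y) →
      ∃ a : ℕ, ∀ K' : ℕ, ∃ (M : ℤ) (y' : localPoints (W.baseChange K) (w.adicCompletion K)),
        (∀ σ : absoluteGaloisGroup (w.adicCompletion K), σ • y' = y') ∧
        IsOfFinAddOrder (((2 : ℤ) ^ a) • y -
          M • pointsMap (W.baseChange K) (w.adicCompletion K)
            (toGeomPoints (W.baseChange K) (Affine.Point.map (W' := W.toAffine) (Algebra.ofId ℚ K) P)) -
          ((2 : ℤ) ^ K') • y') := by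
  haveI : Fact (Nat.Prime 2) := ⟨Nat.prime_two⟩
  set V := W.baseChange K with hV
  set E := w.adicCompletion K with hE
  haveI : CharZero E := charZero_of_injective_algebraMap (algebraMap K E).injective
  haveI : (V.baseChange E).IsElliptic := inferInstanceAs ((V.map (algebraMap K E)).IsElliptic)
  set PK : V.toAffine.Point := Affine.Point.map (W' := W.toAffine) (Algebra.ofId ℚ K) P with hPK
  set Pimg : localPoints V E := pointsMap V E (toGeomPoints V PK) with hPimg
  set ψ : (V.baseChange E).toAffine.Point →+ localPoints V E :=
    Affine.Point.map (W' := V) (IsScalarTower.toAlgHom K E (AlgebraicClosure E)) with hψ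
  -- `P_K` is fixed in `E(K̄_w)`, hence descends to `x₀ ∈ E(K_w)`, of infinite order
  have hPfix : ∀ σ : absoluteGaloisGroup E, σ • Pimg = Pimg := fun σ ↦ by
    rw [hPimg, ← pointsMap_smul, smul_toGeomPoints]
  obtain ⟨x₀, hx₀⟩ := exists_map_eq_of_forall_smul_localPoints_eq V E hPfix
  have hx₀' : ψ x₀ = Pimg := hx₀
  have hPKt : ¬ IsOfFinAddOrder PK := not_isOfFinAddOrder_map_ofId W hP
  have hPimgt : ¬ IsOfFinAddOrder Pimg := by
    intro h
    apply hPKt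
    have hinj : Function.Injective (pointsMap V E) := pointsMapOfEmb_injective V (closureEmb (K := K) E)
    rw [hPimg, hinj.isOfFinAddOrder_iff, (toGeomPoints_injective V).isOfFinAddOrder_iff] at h
    exact h
  have hx₀t : ¬ IsOfFinAddOrder x₀ := fun h ↦ hPimgt (hx₀' ▸ ψ.isOfFinAddOrder h)
  -- the relation in `E(K_w)` transported along `ψ`
  intro y hy
  obtain ⟨Y, hY⟩ := exists_map_eq_of_forall_smul_localPoints_eq V E hy
  have hY' : ψ Y = y := hY
  obtain ⟨a, ha⟩ := exists_rankOne_rel_adicCompletion_two hK.1 hw hw' hne (V.baseChange E) hx₀t Y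
  refine ⟨a, fun K' ↦ ?_⟩
  obtain ⟨M, Y', hM⟩ := ha K'
  refine ⟨M, ψ Y', fun σ ↦ smul_map_baseChange_eq V E ψ hψ Y' σ, ?_⟩
  have := ψ.isOfFinAddOrder hM
  rwa [map_sub, map_sub, map_zsmul, map_zsmul, map_zsmul, hY', hx₀'] at this

/-- **`hH2` ((H2), bottom exhaustion at `v̄`) of cut 14 `restrictedControl_two_of_ptFacts_F1_F3_H2`, VERBATIM, is a theorem.**
[cite: Agboola2007, §6 Prop. 6.11 (arXiv p0014)] [cite: GreenbergLNM1716, §2 Prop. 2.1 and p. 62] [cite: SilvermanAEC2009, Prop. VII.6.3] -/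
theorem hH2_holds :
    ∀ (d : ℤ), d ≠ 0 → Squarefree d → d % 4 ≠ 1 →
      ∀ (W : WeierstrassCurve ℚ) [W.IsElliptic] [W.IsGloballyMinimal] (C : WeierstrassCurve.VariableChange ℚ),
        C • W = cm7.quadraticTwist (d : ℚ) → W.analyticRank = 1 →
      ∀ (K : Type) [Field K] [NumberField K], IsImaginaryQuadratic K →
      ∀ (v vbar : HeightOneSpectrum (𝓞 K)),
        ((2 : ℕ) : 𝓞 K) ∈ v.asIdeal → ((2 : ℕ) : 𝓞 K) ∈ vbar.asIdeal → vbar ≠ v →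
      ∀ (π : (W.baseChange K).endRing), (π : AddMonoid.End (W.baseChange K).geomPoints) * π = π - 2 →
      ∀ (r : ℤ_[2]), r * r = r - 2 →
        (∀ τ ∈ GreenbergSelmer.inertia v, ∀ x : ↥((W.baseChange K).endEigenPrimaryTorsion 2 π r), τ • x = x ∨ τ • x = -x) →
      ∀ (P : W.toAffine.Point) (c₀ : ℕ) (ℓ : ℤ),
        ¬ IsOfFinAddOrder P →
        (∀ R : W.toAffine.Point, ∃ (k : ℤ) (T : W.toAffine.Point), IsOfFinAddOrder T ∧ R = k • P + T) →
        c₀ ≠ 0 → (W.baseChange ℚ_[2]).IsInReductionKernel (c₀ • W.toPadicPoint 2 P) →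
        ‖(W.baseChange ℚ_[2]).padicLogPoint (c₀ • W.toPadicPoint 2 P) / (c₀ : ℚ_[2])‖ = (2 : ℝ) ^ (-ℓ) →
      Finite (restrictedSelmerBase ↥((W.baseChange K).endEigenPrimaryTorsion 2 π r) 2 vbar) →
        (restrictedSelmerBase ↥((W.baseChange K).endEigenPrimaryTorsion 2 π r) 2 v ⊓
            (((W.baseChange K).localKerOver 2 ⊤ (vbar.adicCompletion K)).comap
          (resH1Hom (ContinuousMonoidHom.id _) ((W.baseChange K).endEigenPrimaryTorsion 2 π r).subtype (fun _ _ ↦ rfl)))).map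
            (resOfLe ↥((W.baseChange K).endEigenPrimaryTorsion 2 π r) (inf_le_left : ⊤ ⊓ decomp vbar ≤ ⊤)) ≤
          (((((W.baseChange K).kummerMapPInfty 2 (W.baseChange K).zsmul_geomPoints_surjective_holds).range).map
            (resSubgroup ⊤ ((W.baseChange K).geomPrimaryTorsion 2))).comap
          (resH1Hom (ContinuousMonoidHom.id _) ((W.baseChange K).endEigenPrimaryTorsion 2 π r).subtype (fun _ _ ↦ rfl))).map
            (resOfLe ↥((W.baseChange K).endEigenPrimaryTorsion 2 π r) (inf_le_left : ⊤ ⊓ decomp vbar ≤ ⊤)) := by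
  intro d hd0 _ _ W _ _ C hC _ K _ _ hK v vbar hv hvbar hne π hπ r hr _ P c₀ ℓ hP _ _ _ _ _
  haveI : Fact (Nat.Prime 2) := ⟨Nat.prime_two⟩
  -- the projector
  obtain ⟨hinf, hsup⟩ := endEigenPrimaryTorsion_compl_of_frame hd0 W C hC K π hπ hr
  have hunit : IsUnit (r - (1 - r)) := (two_dvd_or_two_dvd_one_sub_of_root hr).2
  obtain ⟨e, he₁, -, hesub, he⟩ := exists_eigenProjector (W.baseChange K) 2 π r (1 - r) hinf hsup
  -- the rank-one relation at `v̄`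
  have hrel := rankOne_rel_localPoints_of_frame hK hvbar hv hne.symm W hP
  intro x hx
  obtain ⟨x₁, hx₁, rfl⟩ := AddSubgroup.mem_map.mp hx
  have hc : resH1Hom (ContinuousMonoidHom.id _) ((W.baseChange K).endEigenPrimaryTorsion 2 π r).subtype (fun _ _ ↦ rfl) x₁ ∈
      (W.baseChange K).localKerOver 2 ⊤ (vbar.adicCompletion K) := (AddSubgroup.mem_inf.mp hx₁).2
  obtain ⟨n, M, hnM⟩ := exists_resOfLe_eq_zsmul_resOfLe_kummer (W.baseChange K) 2 vbar
    (Affine.Point.map (W' := W.toAffine) (Algebra.ofId ℚ K) P) hrel hc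
  -- abbreviations for the coefficient maps on `⊤` and on `⊤ ⊓ D_v̄`
  have he' : ∀ (σ : ↥(⊤ : Subgroup (absoluteGaloisGroup K))) (y : (W.baseChange K).geomPrimaryTorsion 2),
      e (ContinuousMonoidHom.id _ σ • y) = σ • e y := fun σ y ↦ by
    rw [Subgroup.smul_def, Subgroup.smul_def]; exact he σ y
  have he'' : ∀ (σ : ↥(⊤ ⊓ decomp vbar : Subgroup (absoluteGaloisGroup K))) (y : (W.baseChange K).geomPrimaryTorsion 2),
      e (ContinuousMonoidHom.id _ σ • y) = σ • e y := fun σ y ↦ by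
    rw [Subgroup.smul_def, Subgroup.smul_def]; exact he σ y
  have hι' : ∀ (σ : ↥(⊤ : Subgroup (absoluteGaloisGroup K))) (y : ↥((W.baseChange K).endEigenPrimaryTorsion 2 π r)),
      ((W.baseChange K).endEigenPrimaryTorsion 2 π r).subtype (ContinuousMonoidHom.id _ σ • y) =
        σ • ((W.baseChange K).endEigenPrimaryTorsion 2 π r).subtype y :=
    fun _ _ ↦ rfl
  have hι'' : ∀ (σ : ↥(⊤ ⊓ decomp vbar : Subgroup (absoluteGaloisGroup K))) (y : ↥((W.baseChange K).endEigenPrimaryTorsion 2 π r)),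
      ((W.baseChange K).endEigenPrimaryTorsion 2 π r).subtype (ContinuousMonoidHom.id _ σ • y) =
        σ • ((W.baseChange K).endEigenPrimaryTorsion 2 π r).subtype y :=
    fun _ _ ↦ rfl
  -- the witness on the Kummer line
  have hκ : (W.baseChange K).kummerMapPInfty 2 (W.baseChange K).zsmul_geomPoints_surjective_holds
        (Affine.Point.map (W' := W.toAffine) (Algebra.ofId ℚ K) P ⊗ₜ prufGen 2 n) =
      (W.baseChange K).kummerMapLevel 2 (W.baseChange K).zsmul_geomPoints_surjective_holds n
        (Affine.Point.map (W' := W.toAffine) (Algebra.ofId ℚ K) P) :=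
    kummerMapPInfty_tmul_prufGen (W.baseChange K) 2 (W.baseChange K).zsmul_geomPoints_surjective_holds _ n
  have hq := zsmul_proj_resSubgroup_kummer_mem_comap_kummer (W.baseChange K) 2 π r hinf hsup hunit e hesub he
    (Affine.Point.map (W' := W.toAffine) (Algebra.ofId ℚ K) P ⊗ₜ prufGen 2 n) M
  refine AddSubgroup.mem_map.mpr ⟨_, hq, ?_⟩
  -- compare the two restrictions on `D_v̄`
  rw [map_zsmul, CMPrimes.resOfLe_resH1Hom_id_comm ⊤ (inf_le_left : ⊤ ⊓ decomp vbar ≤ ⊤) e he' he'', hκ,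
    ← map_zsmul (resH1Hom (ContinuousMonoidHom.id _) e he''), ← hnM,
    CMPrimes.resOfLe_resH1Hom_id_comm ⊤ (inf_le_left : ⊤ ⊓ decomp vbar ≤ ⊤)
      ((W.baseChange K).endEigenPrimaryTorsion 2 π r).subtype hι' hι'']
  exact congrArg (fun F ↦ F (resOfLe ↥((W.baseChange K).endEigenPrimaryTorsion 2 π r) (inf_le_left : ⊤ ⊓ decomp vbar ≤ ⊤) x₁))
    (resH1Hom_proj_comp_subtype (W.baseChange K) 2 π r (⊤ ⊓ decomp vbar) e he₁ he)

end Summit.BirchSwinnertonDyer.BirchSwinnertonDyer.Theorems.PrintCf2.CMPrimes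

end
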